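import Literature.Probability.LatticeModels.TemperleyLiebCapNaturality
import HarnessLib

/-!
# Far commutation of cap insertion and contraction: contracting away from a freshly inserted cap («TL-CAP-FAR»)

Topic `Literature/Probability/LatticeModels`; a rider on `TemperleyLiebCapNaturality.lean` / `TemperleyLiebCapContract.lean` (`skip`, `capIns`, `contract`, `contractSucc`,
naturality of the cap under far moves `capIns_connectSucc_of_lt/_of_le`). The remaining «simplicial» identities of the cup–cap calculus (Pearce–Rittenberg–de Gier–Nienhuis's
diagrams): a contraction at a pair of sites disjoint from a freshly inserted cap commutes with the insertion, with the expected index shift: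

* `skip_skip_of_lt` / `skip_skip_of_le` — the two ways of missing two disjoint pairs of consecutive sites agree;
* ★ `PerfectMatching.contract_capIns_of_lt` / `_of_le` — for a pairing `p` pairing `i` with `i+1`: deleting that pair after inserting a cap at `j ≥ i+2` (resp. at `j` with
  `j+2 ≤ i`… i.e. below) is inserting the cap at `j−2` (resp. `j`) after deleting the pair;
* ★★ `LinkPattern.contractSucc_capIns_of_lt` — **`contractSucc i (capIns j P) = capIns (j−2) (contractSucc i P)` for `i + 1 < j`**; ★★ `LinkPattern.contractSucc_capIns_of_le` —
  **`contractSucc (i+2) (capIns j P) = capIns j (contractSucc i P)` for `j ≤ i`**; linear forms ★★ `contractL_comp_capInsL_of_lt` / `_of_le`.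

Together with «TL-CAP-SNAKE» (the two neighbouring positions) and `contractL_comp_capInsL` (the same position) this is the complete table of `contract_i ∘ cap_j`.

## References
* P. A. Pearce, V. Rittenberg, J. de Gier, B. Nienhuis, *Temperley–Lieb stochastic processes*, J. Phys. A 35 (2002) L661–L668, §2 ((monoid): the cup–cap diagram calculus;
  (TL) far commutation `[e_i, e_j] = 0`, `|i − j| > 1`).

## Mathlib / tree
Tree: `TemperleyLiebCapContract.lean` (`skip`, `skip_val`, `skip_injective`, `unskip`, `skip_unskip`, `capIns_partner_castSucc/succ/skip`, `contract`, `skip_contract_partner`,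
`contract_congr`, `LinkPattern.capIns`, `contractSucc`, `capInsL_single`, `contractL_single`), `TemperleyLiebCapNaturality.lean` (`LinkPattern.capIns_connectSucc_of_lt/_of_le`),
`TemperleyLiebPercolationHead.lean` (`LinkPattern.connectSucc_partner_castSucc`). Mathlib: `Finsupp.lhom_ext`.
-/

namespace Literature.Probability.LatticeModels.TemperleyLieb

open Function

section Far

variable {n : ℕ}

/-- missing `{i, i+1}` then `{j, j+1}` (`j ≥ i+2` in the big numbering) = missing `{j−2, j−1}` then `{i, i+1}`. [cite: PearceRittenbergDeGierNienhuis2002, §2 (link diagrams)] -/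
theorem skip_skip_of_lt (i : Fin (n + 1)) (j : Fin (n + 1 + 1 + 1)) (i' : Fin (n + 1 + 1 + 1)) (j' : Fin (n + 1)) (hi' : i'.val = i.val)
    (hj' : j'.val + 2 = j.val) (h : i.val + 1 < j.val) (z : Fin n) : skip j (skip i z) = skip i' (skip j' z) := by
  apply Fin.ext; simp only [skip_val]; split_ifs <;> omega

/-- missing `{i, i+1}` then `{j, j+1}` (`j+1 < i` … i.e. the cap below) = missing `{j, j+1}` then `{i+2, i+3}`. [cite: PearceRittenbergDeGierNienhuis2002, §2 (link diagrams)] -/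
theorem skip_skip_of_le (i : Fin (n + 1)) (j : Fin (n + 1 + 1 + 1)) (i' : Fin (n + 1 + 1 + 1)) (j' : Fin (n + 1)) (hi' : i'.val = i.val + 2)
    (hj' : j'.val = j.val) (h : j.val ≤ i.val) (z : Fin n) : skip j (skip i z) = skip i' (skip j' z) := by
  apply Fin.ext; simp only [skip_val]; split_ifs <;> omega

/-- ★ **deleting the pair `{i, i+1}` after inserting a cap ABOVE it** (`j ≥ i + 2`): the cap lands at `j − 2`.
[cite: PearceRittenbergDeGierNienhuis2002, §2 ((monoid), (TL) far commutation)] -/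
theorem PerfectMatching.contract_capIns_of_lt (p : PerfectMatching (n + 1 + 1)) (i : Fin (n + 1)) (hp : p.partner (Fin.castSucc i) = i.succ)
    (j : Fin (n + 1 + 1 + 1)) (i' : Fin (n + 1 + 1 + 1)) (j' : Fin (n + 1)) (hi' : i'.val = i.val) (hj' : j'.val + 2 = j.val) (h : i.val + 1 < j.val)
    (hq : (PerfectMatching.capIns j p).partner (Fin.castSucc i') = i'.succ) :
    PerfectMatching.contract i' (PerfectMatching.capIns j p) hq = PerfectMatching.capIns j' (PerfectMatching.contract i p hp) := by
  apply PerfectMatching.ext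
  funext x
  apply skip_injective i'
  rw [PerfectMatching.skip_contract_partner]
  -- the three kinds of sites of `capIns j' _`
  by_cases h1 : x = Fin.castSucc j'
  · subst h1
    rw [PerfectMatching.capIns_partner_castSucc]
    have e1 : skip i' (Fin.castSucc j') = Fin.castSucc j := Fin.ext (by rw [skip_val, Fin.val_castSucc, Fin.val_castSucc]; split_ifs <;> omega)
    have e2 : skip i' j'.succ = j.succ := Fin.ext (by rw [skip_val, Fin.val_succ, Fin.val_succ]; split_ifs <;> omega)
    rw [e1, e2, PerfectMatching.capIns_partner_castSucc]
  by_cases h2 : x = j'.succ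
  · subst h2
    rw [PerfectMatching.capIns_partner_succ]
    have e1 : skip i' (Fin.castSucc j') = Fin.castSucc j := Fin.ext (by rw [skip_val, Fin.val_castSucc, Fin.val_castSucc]; split_ifs <;> omega)
    have e2 : skip i' j'.succ = j.succ := Fin.ext (by rw [skip_val, Fin.val_succ, Fin.val_succ]; split_ifs <;> omega)
    rw [e1, e2, PerfectMatching.capIns_partner_succ]
  obtain ⟨z, rfl⟩ : ∃ z, skip j' z = x := ⟨unskip j' x h1 h2, skip_unskip j' x h1 h2⟩
  rw [PerfectMatching.capIns_partner_skip, ← skip_skip_of_lt i j i' j' hi' hj' h, ← skip_skip_of_lt i j i' j' hi' hj' h, PerfectMatching.capIns_partner_skip,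
    PerfectMatching.skip_contract_partner]

/-- ★ **deleting the pair `{i+2, i+3}` after inserting a cap BELOW it** (`j ≤ i`): the cap stays at `j`.
[cite: PearceRittenbergDeGierNienhuis2002, §2 ((monoid), (TL) far commutation)] -/
theorem PerfectMatching.contract_capIns_of_le (p : PerfectMatching (n + 1 + 1)) (i : Fin (n + 1)) (hp : p.partner (Fin.castSucc i) = i.succ)
    (j : Fin (n + 1 + 1 + 1)) (i' : Fin (n + 1 + 1 + 1)) (j' : Fin (n + 1)) (hi' : i'.val = i.val + 2) (hj' : j'.val = j.val) (h : j.val ≤ i.val)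
    (hq : (PerfectMatching.capIns j p).partner (Fin.castSucc i') = i'.succ) :
    PerfectMatching.contract i' (PerfectMatching.capIns j p) hq = PerfectMatching.capIns j' (PerfectMatching.contract i p hp) := by
  apply PerfectMatching.ext
  funext x
  apply skip_injective i'
  rw [PerfectMatching.skip_contract_partner]
  by_cases h1 : x = Fin.castSucc j'
  · subst h1
    rw [PerfectMatching.capIns_partner_castSucc]
    have e1 : skip i' (Fin.castSucc j') = Fin.castSucc j := Fin.ext (by rw [skip_val, Fin.val_castSucc, Fin.val_castSucc]; split_ifs <;> omega)
    have e2 : skip i' j'.succ = j.succ := Fin.ext (by rw [skip_val, Fin.val_succ, Fin.val_succ]; split_ifs <;> omega)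
    rw [e1, e2, PerfectMatching.capIns_partner_castSucc]
  by_cases h2 : x = j'.succ
  · subst h2
    rw [PerfectMatching.capIns_partner_succ]
    have e1 : skip i' (Fin.castSucc j') = Fin.castSucc j := Fin.ext (by rw [skip_val, Fin.val_castSucc, Fin.val_castSucc]; split_ifs <;> omega)
    have e2 : skip i' j'.succ = j.succ := Fin.ext (by rw [skip_val, Fin.val_succ, Fin.val_succ]; split_ifs <;> omega)
    rw [e1, e2, PerfectMatching.capIns_partner_succ]
  obtain ⟨z, rfl⟩ : ∃ z, skip j' z = x := ⟨unskip j' x h1 h2, skip_unskip j' x h1 h2⟩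
  rw [PerfectMatching.capIns_partner_skip, ← skip_skip_of_le i j i' j' hi' hj' h, ← skip_skip_of_le i j i' j' hi' hj' h, PerfectMatching.capIns_partner_skip,
    PerfectMatching.skip_contract_partner]

/-- ★★ **FAR COMMUTATION, cap above**: `contractSucc i (capIns j P) = capIns (j−2) (contractSucc i P)` for `i + 1 < j`.
[cite: PearceRittenbergDeGierNienhuis2002, §2 ((monoid), (TL) `[e_i, e_j] = 0` for `|i − j| > 1`)] -/
theorem LinkPattern.contractSucc_capIns_of_lt (P : LinkPattern (n + 1 + 1)) (i : Fin (n + 1)) (j : Fin (n + 1 + 1 + 1)) (i' : Fin (n + 1 + 1 + 1)) (j' : Fin (n + 1))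
    (hi' : i'.val = i.val) (hj' : j'.val + 2 = j.val) (h : i.val + 1 < j.val) : (P.capIns j).contractSucc i' = (P.contractSucc i).capIns j' := by
  have hnat : (P.capIns j).connectSucc i' = (P.connectSucc i).capIns j := LinkPattern.capIns_connectSucc_of_lt j P i i' h hi'
  apply Subtype.ext
  show PerfectMatching.contract i' ((P.capIns j).connectSucc i').1 ((P.capIns j).connectSucc_partner_castSucc i') =
    PerfectMatching.capIns j' (PerfectMatching.contract i (P.connectSucc i).1 (P.connectSucc_partner_castSucc i))
  have hq : (PerfectMatching.capIns j (P.connectSucc i).1).partner (Fin.castSucc i') = i'.succ := by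
    have e1 : Fin.castSucc i' = skip j (Fin.castSucc i) := Fin.ext (by rw [Fin.val_castSucc, skip_val, Fin.val_castSucc]; split_ifs <;> omega)
    have e2 : i'.succ = skip j i.succ := Fin.ext (by rw [Fin.val_succ, skip_val, Fin.val_succ]; split_ifs <;> omega)
    rw [e1, PerfectMatching.capIns_partner_skip, P.connectSucc_partner_castSucc i, e2]
  rw [PerfectMatching.contract_congr i' (congrArg Subtype.val hnat) ((P.capIns j).connectSucc_partner_castSucc i') hq]
  exact PerfectMatching.contract_capIns_of_lt (P.connectSucc i).1 i (P.connectSucc_partner_castSucc i) j i' j' hi' hj' h hq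

/-- ★★ **FAR COMMUTATION, cap below**: `contractSucc (i+2) (capIns j P) = capIns j (contractSucc i P)` for `j ≤ i`.
[cite: PearceRittenbergDeGierNienhuis2002, §2 ((monoid), (TL) `[e_i, e_j] = 0` for `|i − j| > 1`)] -/
theorem LinkPattern.contractSucc_capIns_of_le (P : LinkPattern (n + 1 + 1)) (i : Fin (n + 1)) (j : Fin (n + 1 + 1 + 1)) (i' : Fin (n + 1 + 1 + 1)) (j' : Fin (n + 1))
    (hi' : i'.val = i.val + 2) (hj' : j'.val = j.val) (h : j.val ≤ i.val) : (P.capIns j).contractSucc i' = (P.contractSucc i).capIns j' := by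
  have hnat : (P.capIns j).connectSucc i' = (P.connectSucc i).capIns j := LinkPattern.capIns_connectSucc_of_le j P i i' h hi'
  apply Subtype.ext
  show PerfectMatching.contract i' ((P.capIns j).connectSucc i').1 ((P.capIns j).connectSucc_partner_castSucc i') =
    PerfectMatching.capIns j' (PerfectMatching.contract i (P.connectSucc i).1 (P.connectSucc_partner_castSucc i))
  have hq : (PerfectMatching.capIns j (P.connectSucc i).1).partner (Fin.castSucc i') = i'.succ := by
    have e1 : Fin.castSucc i' = skip j (Fin.castSucc i) := Fin.ext (by rw [Fin.val_castSucc, skip_val, Fin.val_castSucc]; split_ifs <;> omega)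
    have e2 : i'.succ = skip j i.succ := Fin.ext (by rw [Fin.val_succ, skip_val, Fin.val_succ]; split_ifs <;> omega)
    rw [e1, PerfectMatching.capIns_partner_skip, P.connectSucc_partner_castSucc i, e2]
  rw [PerfectMatching.contract_congr i' (congrArg Subtype.val hnat) ((P.capIns j).connectSucc_partner_castSucc i') hq]
  exact PerfectMatching.contract_capIns_of_le (P.connectSucc i).1 i (P.connectSucc_partner_castSucc i) j i' j' hi' hj' h hq

variable {R : Type*} [CommRing R]

/-- ★★ linear form, cap above: `contractL i' ∘ capInsL j = capInsL (j−2) ∘ contractL i` (`i + 1 < j`). [cite: PearceRittenbergDeGierNienhuis2002, §2 (TL)] -/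
theorem contractL_comp_capInsL_of_lt (i : Fin (n + 1)) (j : Fin (n + 1 + 1 + 1)) (i' : Fin (n + 1 + 1 + 1)) (j' : Fin (n + 1))
    (hi' : i'.val = i.val) (hj' : j'.val + 2 = j.val) (h : i.val + 1 < j.val) :
    contractL R i' ∘ₗ capInsL R j (n := n + 1 + 1) = capInsL R j' ∘ₗ contractL R i := by
  refine Finsupp.lhom_ext fun P c => ?_
  rw [LinearMap.comp_apply, LinearMap.comp_apply, capInsL_single, contractL_single, contractL_single, capInsL_single,
    LinkPattern.contractSucc_capIns_of_lt P i j i' j' hi' hj' h]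

/-- ★★ linear form, cap below: `contractL (i+2) ∘ capInsL j = capInsL j ∘ contractL i` (`j ≤ i`). [cite: PearceRittenbergDeGierNienhuis2002, §2 (TL)] -/
theorem contractL_comp_capInsL_of_le (i : Fin (n + 1)) (j : Fin (n + 1 + 1 + 1)) (i' : Fin (n + 1 + 1 + 1)) (j' : Fin (n + 1))
    (hi' : i'.val = i.val + 2) (hj' : j'.val = j.val) (h : j.val ≤ i.val) :
    contractL R i' ∘ₗ capInsL R j (n := n + 1 + 1) = capInsL R j' ∘ₗ contractL R i := by
  refine Finsupp.lhom_ext fun P c => ?_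
  rw [LinearMap.comp_apply, LinearMap.comp_apply, capInsL_single, contractL_single, contractL_single, capInsL_single,
    LinkPattern.contractSucc_capIns_of_le P i j i' j' hi' hj' h]

end Far

end Literature.Probability.LatticeModels.TemperleyLieb
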